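import Literature.MathematicalPhysics.QuantumFieldTheory.Balaban1983to89.Node00.HistoryTermDatum214Inputs226
import Literature.MathematicalPhysics.QuantumFieldTheory.Balaban1983to89.B13Term214ParamHolo

/-!
# `Balaban1983to89.B13TermDatum214ParamHolo` — T. Bałaban, *Renormalization group approach to lattice gauge field theories. II.
Cluster expansions*, Commun. Math. Phys. **116** (1988) 1–22 [Balaban1988RG2Cluster], (2.14) p. 15 with Lemma 2 ∕ (1.41) p. 11: THE (2.14)
TERM OF THE W1 TERM DATUM IS HOLOMORPHIC ALONG ANY HOLOMORPHICALLY PARAMETRISED HISTORY, with the (2.26) weight bound along it — the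
per-term schema «(S-226-T)» of the Summit-side N22 modules, BOTH halves, from ONE record of located (2.26) inputs

statement-level skeleton of published theorems with citation tags; proofs where landed; nothing here is a claim about the
Yang–Mills mass gap

CITATION HEADER (verbatim).  [II] p. 15 [PDF 15], (2.14) and *"We consider it as an analytic function of (𝐔, 𝐉) …, and of the complex
parameters σ(Z), τ"*; p. 11 [PDF 11], Lemma 2: the older terms `E^{(j)}`, `j ≤ k`, enter the step through the potentials `𝐕_k(Y, ·)` of
(1.41) (linearly, (1.33) → (1.41)); p. 16 [PDF 16], (2.20): `Σ_{Y∈𝐃}|τ(Y)||𝐕_k(Y,B)| ≦ ½a₂₀‖B‖² + O(1)`; p. 17 [PDF 17], (2.26).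
[I] = [Balaban1987RG1] p. 263 [PDF 15]: the inductive description types `E^{(j)}` as a `C^∞` (or analytic) function of the coupling.

WHY (cell `pub-ymgap`, Track A node N10 [B13], seat `pub-ymgap-dag-n10-c` g5; count-neutral).  Node00-def-W1's term datum
`𝔇 : W1.TermDatum214 c₀ P 𝔸 M k L` (storey 7) DEFINES the (2.14) term `𝔇.TF Z t s old φ := term214 r (Z∖Z′₀) 𝐃 (core214 A Γ (F214 |P| χ(s) χᶜ(s) 𝐃
(𝒱 Z t s old φ))) 0 0`; storey 8 bundles the LOCATED (2.26) inputs of one term as the record `𝔇.Inputs226Holo c Z t s old φ a a₅` and keys the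
(2.26) socket `norm_TF_le_weight_of_inputs226Holo` on it.  The Summit-side per-term schema (S-226-T) of node N22
(`…N22W1StripTermDatum214` binder `h226T`) asks, for a holomorphically parametrised history `cv : ℂ → OlderTerms`, BOTH
`DifferentiableOn ℂ (fun z => 𝔇.TF Z t s (cv z) φ) D` AND `∀ z ∈ D, ‖𝔇.TF Z t s (cv z) φ‖ ≤ weight·e^{a₅|Z|}` — the lens memo
`ym-lens-BalabanUVNodes-transfer` T11 located the first half as «N10's holomorphic-parameter Gaussian ∕ Cauchy device on core214 ∕ term214,
no new estimate».  In the record `Inputs226Holo` the history `old` is read by exactly TWO fields — the measurability `hVm` of Lemma 2's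
potentials `𝒱 Z t s old φ Y` and their (2.20) bound `h220U` on the per-domain τ-region; every other located input (the kernels' letters,
the characteristic functions at the coupling, the regions, rates and numerics) is history-free.  THIS FILE:
* §1 `primitiveInputs226Holo_of_potentials` — the located inputs TRANSPORT along the history: a record at `old` plus measurability and the
  (2.20) bound (same letters `a₂₀, w`, same τ-region) of the potentials at `old′` give the located inputs at `old′`;
* §2 ★ `differentiableOn_TF_of_inputs226Holo` — THE HOLOMORPHY HALF: one record `ι` at some history, a parametrisation `cv : Pm → OlderTerms`
  over an open `W` of any complex normed space with `p ↦ 𝒱 Z t s (cv p) φ Y B` complex differentiable on `W`, `𝒱 Z t s (cv p) φ Y` measurable and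
  (2.20) with `ι`'s letters on `ι`'s τ-region UNIFORMLY in `p ∈ W` ⟹ `p ↦ 𝔇.TF Z t s (cv p) φ` is complex differentiable on `W` — ONE application
  of `B13Term214ParamHolo.differentiableOn_term214_torus_of_primitives_holo_polyτ` at the datum's pins (kernel record `𝒦 Z t`, `uOf`, `r`, the
  lists `sigmaList ∕ tauList`), field by field from `ι`;
* §3 ★ `h226T_of_inputs226Holo` — BOTH HALVES in the exact shape of N22's per-term binder: `DifferentiableOn ℂ (fun p => 𝔇.TF Z t s (cv p) φ) W ∧
  ∀ p ∈ W, ‖𝔇.TF Z t s (cv p) φ‖ ≤ weight L M c Z a t · exp(a₅|Z|)` (§2 + storey 8's socket through §1 at each `p`).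
What a consumer still supplies: the record `ι` (NODE A's kernel letters, the characteristic functions' (2.22), numerics — unchanged), and the
three history letters of the potentials along the curve; under print's LAW for 𝐕_k (a finite linear combination of evaluations of the older
terms on the small-field spaces, [II] (1.33)–(1.41) — def-W1's ∕ node N09's, NOT typed here) the holomorphy letter `hVd` is coordinatewise
holomorphy of the curve and the uniform (2.20) is Lemma 2's (1.43) with the (1.18)-size of the curve.

HONEST FRAMING.  Count-neutral kernel bookkeeping: three applications of landed generic theorems at the datum's pins; the datum is DATA, the
record is a LIST OF HYPOTHESES, the history letters are HYPOTHESES; nothing of Bałaban's asserted or constructed; nodes N10 ∕ N22 NOT discharged;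
K-items untouched; one finite 𝕋⁴ programme at fixed ε — NOT continuum, NOT infinite volume, NOT OS, NOT mass gap, NOT Clay.  0 sorry, 0 `def`,
standard axioms.
-/

noncomputable section

namespace Literature.MathematicalPhysics.QuantumFieldTheory.Balaban1983to89.B13TermDatum214ParamHolo

open Metric Set Matrix
open scoped BigOperators
open Literature.MathematicalPhysics.QuantumFieldTheory.Balaban1983to89
open Step B14.Eq213MaximalDomains TreeLengthTorus T4Continuum
open Literature.MathematicalPhysics.QuantumFieldTheory.Balaban1983to89.Node00.Sect2
open Literature.MathematicalPhysics.QuantumFieldTheory.Balaban1983to89.Node00.W1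
open Literature.MathematicalPhysics.QuantumFieldTheory.Balaban1983to89.B13Lemma3TorusTerms (weight)
open Literature.MathematicalPhysics.QuantumFieldTheory.Balaban1983to89.B13Term214ParamHolo
  (differentiableOn_term214_torus_of_primitives_holo_polyτ)

variable {c₀ : B13.Consts} {P : Params} {𝔸 : Type*} {M k L : ℕ} [NeZero L] (𝔇 : TermDatum214 c₀ P 𝔸 M k L)

/-! ## §1  The located (2.26) inputs transport along the history -/

/-- **THE LOCATED (2.26) INPUTS READ THE HISTORY ONLY THROUGH LEMMA 2's POTENTIALS**: a record of located inputs at the history `old`, together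
with the measurability of the potentials `𝒱 Z t s old′ φ Y` and their (2.20) bound on the record's per-domain τ-region with the record's letters
`a₂₀, w` at another history `old′`, gives the located inputs at `old′` (every other field of `Inputs226Holo` is history-free).
[cite: Balaban1988RG2Cluster, (2.20) p.16 and (1.41) p.11, (2.26) p.17] -/
theorem primitiveInputs226Holo_of_potentials {c : B13.Consts} {Z : (domSys P M (k + 1)).Dom} {t : TermLabel P M k L} {s : ℂ}
    {old : OlderTerms P 𝔸 M k} {φ : CPair P 𝔸} {a a₅ : ℝ} (ι : 𝔇.Inputs226Holo c Z t s old φ a a₅)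
    {old' : OlderTerms P 𝔸 M k} (hVm : ∀ Y, Measurable (𝔇.𝒱 Z t s old' φ Y))
    (h220U : ∀ τ : TDom P.d (L * domCount P M (k + 1)) → ℂ, (∀ Y, τ Y ∈ ι.Uτ Y) →
      ∀ B, ∑ Y ∈ t.1, ‖τ Y‖ * ‖𝔇.𝒱 Z t s old' φ Y B‖ ≤ ι.a₂₀ / 2 * (B ⬝ᵥ B) + ι.w) :
    𝔇.PrimitiveInputs226Holo c Z t s old' φ a a₅ :=
  ⟨{ ι with hVm := hVm, h220U := h220U }⟩

/-! ## §2  The (2.14) term of the datum is holomorphic along a holomorphically parametrised history -/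

/-- **THE (2.14) TERM OF THE DATUM IS HOLOMORPHIC ALONG ANY HOLOMORPHICALLY PARAMETRISED HISTORY** ((H-old), the holomorphy half of the
Summit-side per-term schema (S-226-T)).  Data: one record `ι : 𝔇.Inputs226Holo c Z t s old₀ φ a a₅` of located (2.26) inputs of the term at
SOME history `old₀` (NODE A's kernel letters on the open σ-polydisc, the characteristic functions at the coupling `s` with (2.22), the regions,
rates, numerics); a parametrisation `cv : Pm → OlderTerms` of histories over an open `W` of any complex normed space such that Lemma 2's
potentials along it are complex differentiable in the parameter (`hVd`, for every domain `Y` and field `B`), measurable in the field (`hVm`),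
and obey (2.20) with the record's letters `a₂₀, w` on the record's per-domain τ-region UNIFORMLY in `p ∈ W` (`h220W`).  Conclusion:
`p ↦ 𝔇.TF Z t s (cv p) φ` is complex differentiable on `W` — `B13Term214ParamHolo.differentiableOn_term214_torus_of_primitives_holo_polyτ` at
the datum's pins, field by field from `ι` (the term IS the finite signed double difference of corner values of the X-integral, each
holomorphic under the integral sign with the (2.15)–(2.23) majorant, uniform in `p`).  No estimate is proved here.
[cite: Balaban1988RG2Cluster, (2.14)–(2.15) p.15, (2.16)–(2.22) p.16, (2.23)–(2.26) p.17, Lemma 2 and (1.41) p.11; Balaban1987RG1, p.263] -/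
theorem differentiableOn_TF_of_inputs226Holo {c : B13.Consts} {Z : (domSys P M (k + 1)).Dom} {t : TermLabel P M k L} {s : ℂ}
    {old₀ : OlderTerms P 𝔸 M k} {φ : CPair P 𝔸} {a a₅ : ℝ} (ι : 𝔇.Inputs226Holo c Z t s old₀ φ a a₅)
    {Pm : Type*} [NormedAddCommGroup Pm] [NormedSpace ℂ Pm] {W : Set Pm} (hW : IsOpen W) (cv : Pm → OlderTerms P 𝔸 M k)
    (hVm : ∀ p ∈ W, ∀ Y, Measurable (𝔇.𝒱 Z t s (cv p) φ Y))
    (hVd : ∀ Y B, DifferentiableOn ℂ (fun p => 𝔇.𝒱 Z t s (cv p) φ Y B) W)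
    (h220W : ∀ p ∈ W, ∀ τ : TDom P.d (L * domCount P M (k + 1)) → ℂ, (∀ Y, τ Y ∈ ι.Uτ Y) →
      ∀ B, ∑ Y ∈ t.1, ‖τ Y‖ * ‖𝔇.𝒱 Z t s (cv p) φ Y B‖ ≤ ι.a₂₀ / 2 * (B ⬝ᵥ B) + ι.w) :
    DifferentiableOn ℂ (fun p => 𝔇.TF Z t s (cv p) φ) W :=
  differentiableOn_term214_torus_of_primitives_holo_polyτ c hW ι.hUσ ι.hUτ ι.hUexp ι.hr ι.hr' ι.hsubτ
    (sigmaList_spec Z t).1 (tauList_spec t).1 (𝔇.A Z t φ) (𝔇.Gam Z t φ) t.2.card (𝔇.chiY₀ Z t s) (𝔇.chicP Z t s)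
    ι.hχ0 ι.hχc0 t.1 (fun p => 𝔇.𝒱 Z t s (cv p) φ) (𝔇.𝒦 Z t).hC (𝔇.𝒦 Z t).Γ₀ ι.hAhol ι.hχm ι.hχcm hVm hVd ι.hAs ι.hA
    (fun σ => (𝔇.𝒦 Z t).G2 σ (𝔇.uOf Z t φ)) ι.hGhol (fun _ _ _ => rfl) ι.qP ι.h222 ι.hγ₂ ι.hqP ι.ha0 h220W
    (𝔇.𝒦 Z t).locΛ (𝔇.𝒦 Z t).locN (𝔇.𝒦 Z t).hfib ι.hfibN ι.hkap'' ι.h1 ι.h2 ι.hθE ι.hθΓ ι.hθC ι.hKG ι.hKΓ ι.hKCs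
    ι.hK₀ ι.hθEle ι.hθΓle ι.hθR1le ι.hG ι.hΓ₀ ι.hCs ι.hC216 ι.hdΓ ι.hdC ι.hdE ι.hsmallKθ ι.hc0 ι.hc ι.hαc ι.hΓq
    ι.hsmall

/-! ## §3  Both halves of the per-term schema (S-226-T) from one record -/

/-- **THE PER-TERM SCHEMA (S-226-T) OF NODE N22, BOTH HALVES, FROM ONE RECORD OF LOCATED INPUTS**: under the data of
`differentiableOn_TF_of_inputs226Holo` and the two global numerals `1 ≤ κ₁`, `α₆ ≠ 0` of the (2.26) socket,
`p ↦ 𝔇.TF Z t s (cv p) φ` is complex differentiable on `W` AND `‖𝔇.TF Z t s (cv p) φ‖ ≤ weight L M c Z a t · exp(a₅|Z|)` for every `p ∈ W` — the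
exact body of the Summit-side binder `h226T` at `TF := 𝔇.TF` along the curve (holomorphy: §2; weight: node00-def-W1's socket
`norm_TF_le_weight_of_inputs226Holo` through the transport §1 at each `p`).
[cite: Balaban1988RG2Cluster, (2.14) p.15, (2.20) p.16, (2.26) p.17, Lemma 2 p.11; Balaban1987RG1, p.263] -/
theorem h226T_of_inputs226Holo {c : B13.Consts} (hκ₁ : 1 ≤ c.κ₁) (hα₆ : c.α₆ ≠ 0) {Z : (domSys P M (k + 1)).Dom}
    {t : TermLabel P M k L} {s : ℂ} {old₀ : OlderTerms P 𝔸 M k} {φ : CPair P 𝔸} {a a₅ : ℝ}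
    (ι : 𝔇.Inputs226Holo c Z t s old₀ φ a a₅)
    {Pm : Type*} [NormedAddCommGroup Pm] [NormedSpace ℂ Pm] {W : Set Pm} (hW : IsOpen W) (cv : Pm → OlderTerms P 𝔸 M k)
    (hVm : ∀ p ∈ W, ∀ Y, Measurable (𝔇.𝒱 Z t s (cv p) φ Y))
    (hVd : ∀ Y B, DifferentiableOn ℂ (fun p => 𝔇.𝒱 Z t s (cv p) φ Y B) W)
    (h220W : ∀ p ∈ W, ∀ τ : TDom P.d (L * domCount P M (k + 1)) → ℂ, (∀ Y, τ Y ∈ ι.Uτ Y) →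
      ∀ B, ∑ Y ∈ t.1, ‖τ Y‖ * ‖𝔇.𝒱 Z t s (cv p) φ Y B‖ ≤ ι.a₂₀ / 2 * (B ⬝ᵥ B) + ι.w) :
    DifferentiableOn ℂ (fun p => 𝔇.TF Z t s (cv p) φ) W ∧
      ∀ p ∈ W, ‖𝔇.TF Z t s (cv p) φ‖ ≤ weight L M c Z a t * Real.exp (a₅ * ((Z.1).card : ℝ)) :=
  ⟨differentiableOn_TF_of_inputs226Holo 𝔇 ι hW cv hVm hVd h220W, fun p hp =>
    TermDatum214.norm_TF_le_weight_of_inputs226Holo hκ₁ hα₆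
      (primitiveInputs226Holo_of_potentials 𝔇 ι (hVm p hp) (h220W p hp))⟩

/-! ## §4  (v1.1) The located inputs restrict to BOUNDED per-domain τ-regions — the τ-region's size is a letter of the record -/

/-- **THE LOCATED (2.26) INPUTS RESTRICT TO BOUNDED PER-DOMAIN τ-REGIONS** (v1.1).  A record `ι` of located inputs keeps every letter when
its per-domain τ-regions `ι.Uτ Y` are intersected with the open discs `|τ| < r̂(Y) + r + 2`, where `r̂(Y) = (invTau c d(Y))⁻¹` is print's
τ-radius (2.18) and `r` the datum's Cauchy radius: the intersections are open, still contain the closed `r̂(Y)`-disc and the closed `r`-discs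
around `[0, 1]`, and (2.20) on the smaller region is (2.20) on the larger one restricted.  Hence from ANY record one obtains a record with the
SAME letters `a₂₀, w`, τ-regions INSIDE the old ones, on which `Σ_{Y ∈ 𝐃(t)} |τ(Y)| ≤ Σ_{Y ∈ 𝐃(t)} (r̂(Y) + r + 2)`: the «τ-region size»
a consumer of §3 along a Banach section needs (Summit-side module 107's binder `hτ`, the N22 junction J69's `∃ τs` row) is a LETTER OF THE
RECORD, not an extra hypothesis.  Pure bookkeeping; no estimate of print's is proved.
[cite: Balaban1988RG2Cluster, (2.18) p.16, (2.20) p.16] -/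
theorem exists_inputs226Holo_tauBounded {c : B13.Consts} {Z : (domSys P M (k + 1)).Dom} {t : TermLabel P M k L} {s : ℂ}
    {old : OlderTerms P 𝔸 M k} {φ : CPair P 𝔸} {a a₅ : ℝ} (ι : 𝔇.Inputs226Holo c Z t s old φ a a₅) :
    ∃ ι' : 𝔇.Inputs226Holo c Z t s old φ a a₅,
      (∀ Y, ι'.Uτ Y ⊆ ι.Uτ Y) ∧ ι'.a₂₀ = ι.a₂₀ ∧ ι'.w = ι.w ∧
      ∀ τ : TDom P.d (L * domCount P M (k + 1)) → ℂ, (∀ Y, τ Y ∈ ι'.Uτ Y) →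
        ∑ Y ∈ t.1, ‖τ Y‖ ≤ ∑ Y ∈ t.1, ((B13Bound143.invTau c ((tsys P.d (L * domCount P M (k + 1))).dj Y))⁻¹ + 𝔇.r + 2) := by
  have hinv0 : ∀ Y : TDom P.d (L * domCount P M (k + 1)),
      0 < (B13Bound143.invTau c ((tsys P.d (L * domCount P M (k + 1))).dj Y))⁻¹ := fun Y => inv_pos.2 (ι.hpos Y)
  have hρpos : ∀ Y : TDom P.d (L * domCount P M (k + 1)),
      (B13Bound143.invTau c ((tsys P.d (L * domCount P M (k + 1))).dj Y))⁻¹ <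
        (B13Bound143.invTau c ((tsys P.d (L * domCount P M (k + 1))).dj Y))⁻¹ + 𝔇.r + 2 := fun Y => by linarith [ι.hr]
  have hdisc : ∀ Y : TDom P.d (L * domCount P M (k + 1)), ∀ x ∈ Set.uIcc (0 : ℝ) 1,
      closedBall (x : ℂ) 𝔇.r ⊆ ball (0 : ℂ) ((B13Bound143.invTau c ((tsys P.d (L * domCount P M (k + 1))).dj Y))⁻¹ + 𝔇.r + 2) := by
    intro Y x hx z hz
    rw [Set.uIcc_of_le zero_le_one] at hx
    have hx1 : ‖(x : ℂ)‖ ≤ 1 := by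
      rw [Complex.norm_real, Real.norm_eq_abs]
      exact abs_le.2 ⟨by linarith [hx.1], hx.2⟩
    have hzx : ‖z - (x : ℂ)‖ ≤ 𝔇.r := by rw [← dist_eq_norm]; exact mem_closedBall.1 hz
    rw [mem_ball_zero_iff]
    calc ‖z‖ = ‖(z - (x : ℂ)) + (x : ℂ)‖ := by rw [sub_add_cancel]
      _ ≤ ‖z - (x : ℂ)‖ + ‖(x : ℂ)‖ := norm_add_le _ _
      _ ≤ 𝔇.r + 1 := add_le_add hzx hx1
      _ < _ := by linarith [hinv0 Y]
  refine ⟨{ ι with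
      Uτ := fun Y => ι.Uτ Y ∩ ball (0 : ℂ) ((B13Bound143.invTau c ((tsys P.d (L * domCount P M (k + 1))).dj Y))⁻¹ + 𝔇.r + 2)
      hUτ := fun Y => (ι.hUτ Y).inter isOpen_ball
      hUtau := fun Y => subset_inter (ι.hUtau Y) (closedBall_subset_ball (hρpos Y))
      hsubτ := fun Y x hx => subset_inter (ι.hsubτ Y x hx) (hdisc Y x hx)
      h220U := fun τ hτ B => ι.h220U τ (fun Y => (hτ Y).1) B }, fun Y => inter_subset_left, rfl, rfl, fun τ hτ => ?_⟩
  refine Finset.sum_le_sum fun Y _ => ?_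
  have h : τ Y ∈ ι.Uτ Y ∩ ball (0 : ℂ) ((B13Bound143.invTau c ((tsys P.d (L * domCount P M (k + 1))).dj Y))⁻¹ + 𝔇.r + 2) := hτ Y
  exact (mem_ball_zero_iff.1 h.2).le

end Literature.MathematicalPhysics.QuantumFieldTheory.Balaban1983to89.B13TermDatum214ParamHolo

end
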